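import Summits.Ventures.YMGap.Thresholds.StarLimitSUN
import Summits.Ventures.YMGap.Thresholds.StarSUNRows
import Summits.Ventures.YMGap.Thresholds.SharpStrongCoupling
import Summits.Ventures.YMGap.StrongCouplingGapFromCertificate
import HarnessLib

/-!
# Venture YMGap — track (c) «DS» meets track (a): the cell's TARGET TYPE `ImprovedThreshold 4 N (9/308)`
# for EVERY `SU(N)`, `N ≥ 2`, hypothesis-free, from the generic-`N` star window

HONEST FRAMING: venture file (cell `pub-ymgap`), strong-coupling LATTICE statements for `SU(N)` lattice
Yang–Mills on `ℤ⁴` with the Wilson action (tree coupling `N·x`, 't Hooft coupling `x`); nothing about the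
continuum, confinement at weak coupling, or the Millennium problem.  This is the `SU(N)` twin of ds-2's
capstone `StarLimitClustering.su2Star_massGapAt_of_unique` (typed for `SU(2)` and the schema `StarWindowBound`):
`MassGapAt` from the limit-state clustering clause (`StarLimitSUN.star_limitState_clustering`) plus DLR
uniqueness — fed with the generic-`N` star window `StarLemmaGSUN.star_window_of_oneLinkKRModulus` (this seat,
p331109) and the uniqueness rows of `StarSUNRows`.  OUTPUT, hypothesis-free, for every `N ≥ 2` (Bakry–Émery
modulus `oneLinkKRModulus_SU`; the whole chain sees only `|x|`, so no sign-flip symmetry is used):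

* `massGapAt_SU_star : 2 ≤ N → |x| ≤ 9/308 → MassGapAt 4 N x`;
* `massGapBelow_SU_star : MassGapBelow 4 N (9/308)`;
* `dlrMassGapAt_SU_star : |x| ≤ 9/308 → DLRMassGapAt 4 N x` (the SC-a Literature currency, dictionary);
* `strongCouplingPhaseAt_SU_star : |β|/N ≤ 9/308 → HessianSharp.StrongCouplingPhaseAt 4 N β` (p2's bridge);
* `improvedThreshold_SU_star : ImprovedThreshold 4 N (9/308)` — the cell's track-(a) TARGET TYPE
  (`StrongCouplingGapShape.ImprovedThreshold d N β₀' := 1/(16(d−1)) < β₀' ∧ MassGapBelow d N β₀'`) at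
  `d = 4` for EVERY `N ≥ 2`: `1/48 = 0.02083… < 9/308 = 0.02922…` (×`108/77 = 1.40`).

For comparison (each in its own class): PRINTED Shen–Zhu–Zhu `|x| < 1/48` (= the tree's hypothesis-free
`shen_zhu_zhu_holds` / `dlrMassGapAt_SU`); the cell's sharp Bakry–Émery threshold `1/(8d) = 1/32 = 0.03125`
for all `N`, conditional on three printed facts (`HessianSharp.improvedThreshold_sharp`); for `SU(2)` the
sharp quarter-modulus row `ImprovedThreshold 4 2 (9/100)` (ds-3, `ImprovedThresholdStar`) supersedes this one.
No rate is claimed beyond `∃ c > 0` (the star rate `κ(ρ)` is tiny near the door); no transfer-matrix gap.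
-/

noncomputable section

open MeasureTheory ProbabilityTheory Function Finset Filter Topology
open scoped NNReal
open Literature.Probability.LatticeModels
open Literature.Probability.LatticeModels.DobrushinMetric
open Literature.MathematicalPhysics.QuantumLattice (toTorusObservable toTorusObservable_apply IsCylinder
  LGConfig torusLift torusEdge fundamentalRep infiniteVolumeLimitPoints IsInfiniteVolumeLimitAlong
  ymSpecification ymGibbsMeasures continuous_fundamentalRep
  mem_ymGibbsMeasures_of_mem_infiniteVolumeLimitPoints_holds infiniteVolumeLimitPoints_nonempty_holds)
open Literature.MathematicalPhysics.QuantumFieldTheory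
open Literature.MathematicalPhysics.QuantumFieldTheory.Balaban1983to89
open Literature.MathematicalPhysics.QuantumFieldTheory.Balaban1983to89.StrongCouplingTorusWindow
open Literature.MathematicalPhysics.QuantumFieldTheory.Balaban1983to89.StrongCouplingDobrushinWindow
  (OneLinkKRModulus)
open Literature.MathematicalPhysics.QuantumFieldTheory.Balaban1983to89.StrongCouplingKernelWindow
  (oneLinkKRModulus_SU)
open Summit.QuantumFields.BalabanUV.InfraRed.StrongCouplingVarianceDoorSUN
  (OneLinkVarianceBound oneLinkKRModulus_of_varianceBound)
open Summit.Ventures.YMGap.DSWindow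
open Summit.Ventures.YMGap.StarWindowGauge (gaugeR Delta_pos gaugeR_lt_one_of_le)
open Summit.Ventures.YMGap.StarLemmaG (Karr gaugeR_nonneg)
open Summit.Ventures.YMGap.StarLemmaGSUN
open Summit.Ventures.YMGap.StarLimit (abs_cov_le_of_eventually_torus continuous_of_isLipschitzCylinder
  linkObs_toTorusObservable setDistEdges_le_supNorm)

namespace Summit.Ventures.YMGap.StarSUNLimit

variable {N : ℕ}

section Limit

/-! ### The capstone: `MassGapAt 4 N x` from star windows plus DLR uniqueness -/

/-- **The track-(a) currency from star windows on all large tori plus DLR uniqueness** (`SU(N)`, `d = 4`):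
at 't Hooft coupling `x` (tree coupling `N·x`), if every torus of side `L ≥ L₁` carries a star-window
influence array (four clauses, one `ρ < 1`) for the torus Wilson specification at tree coupling `N·x`, and
the DLR state of the `ℤ⁴` specification at `N·x` is unique, then `Summit.Ventures.YMGap.MassGapAt 4 N x`
(the unique DLR state is an infinite-volume limit point, and `star_limitState_clustering` applies).  Port of
`StarLimit.su2Star_massGapAt_of_unique`. [folklore] -/
theorem star_massGapAt_of_unique (x : ℝ) {ρ : ℝ} (hρ0 : 0 ≤ ρ) (hρ1 : ρ < 1) (L₁ : ℕ)
    (hW : ∀ (L : ℕ) [NeZero L], L₁ ≤ L → ∃ Kw : Site 4 L → Edge 4 L → Edge 4 L → ℝ,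
      (∀ s y e, 0 ≤ Kw s y e) ∧ (∀ s y e, Kw s y e ≠ 0 → ∀ w ∈ linkEnds y, torusNorm (s - w) ≤ 1) ∧
      IsLinkWindowContraction (d := 4) (L := L) (wilsonPlaqWeight N ((N : ℝ) * x)) suFrobDist starWin
        (fun c => Kw c.1) ∧
      ∀ (s : Site 4 L) (e : Edge 4 L), e ∈ vertexStar s → ∑ y, Kw s y e ≤ ρ)
    (huniq : HasUniqueGibbsMeasure (ymSpecification (d := 4) (fundamentalRep (Fin N)) ((N : ℝ) * x))) :
    MassGapAt 4 N x := by
  haveI : SecondCountableTopology (Matrix (Fin N) (Fin N) ℂ) :=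
    inferInstanceAs (SecondCountableTopology (Fin N → Fin N → ℂ))
  haveI : SecondCountableTopology (Matrix.specialUnitaryGroup (Fin N) ℂ) :=
    Topology.IsEmbedding.subtypeVal.secondCountableTopology
  refine ⟨huniq, fun μ hμ => ?_⟩
  have hρc := continuous_fundamentalRep (Fin N)
  -- the unique DLR state is a limit point of the torus states at tree coupling `N·x`
  obtain ⟨ν, hν⟩ := infiniteVolumeLimitPoints_nonempty_holds (d := 4) (fundamentalRep (Fin N)) hρc
    ((N : ℝ) * x)
  have hνG : ν ∈ ymGibbsMeasures (d := 4) (fundamentalRep (Fin N)) ((N : ℝ) * x) :=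
    mem_ymGibbsMeasures_of_mem_infiniteVolumeLimitPoints_holds (d := 4) (fundamentalRep (Fin N)) hρc hν
  have hμν : μ = ν := huniq.1 hμ hνG
  have hμlim : μ ∈ infiniteVolumeLimitPoints (d := 4) (fundamentalRep (Fin N)) ((N : ℝ) * x) := by
    rw [hμν]; exact hν
  refine ⟨starRate ρ, starRate_pos hρ0 hρ1, fun n => ?_⟩
  obtain ⟨c₁, hc₁⟩ := star_limitState_clustering ((N : ℝ) * x) hρ0 hρ1 L₁ hW μ hμlim n
  exact ⟨c₁, fun F₁ F₂ Λ₁ Λ₂ K₁ K₂ h₁ h₂ hd hF₁ hF₂ => hc₁ F₁ F₂ Λ₁ Λ₂ K₁ K₂ h₁ h₂ hd hF₁ hF₂⟩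

/-- **`MassGapAt 4 N x` from a one-link modulus** (`SU(N)`): `OneLinkKRModulus N R K` with `K ≥ 0` on the
tilt ball `R ≥ 6|x|` and `4K|x| ≤ 9/25` gives the star windows on every torus of side `≥ 3`
(`StarLemmaGSUN.star_window_of_oneLinkKRModulus`, received sum `R_G(4K|x|) < 1`) and DLR uniqueness
(`StarSUN.hasUniqueGibbsMeasure_of_oneLinkKRModulus`), hence `MassGapAt 4 N x`. [folklore] -/
theorem star_massGapAt_of_oneLinkKRModulus (hN : 1 ≤ N) {x R K : ℝ} (hK0 : 0 ≤ K) (hR : |x| * 6 ≤ R)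
    (hmod : OneLinkKRModulus N R K) (h : 4 * (K * |x|) ≤ 9 / 25) : MassGapAt 4 N x := by
  have hN0 : (0 : ℝ) < N := by exact_mod_cast (show 0 < N by omega)
  have ex : |(N : ℝ) * x| / N = |x| := by
    rw [abs_mul, abs_of_pos hN0, mul_div_cancel_left₀ _ hN0.ne']
  have hR' : |(N : ℝ) * x| / N * 6 ≤ R := by rw [ex]; exact hR
  have h' : 4 * (K * (|(N : ℝ) * x| / N)) ≤ 9 / 25 := by rw [ex]; exact h
  have hc0 : 0 ≤ K * |x| := mul_nonneg hK0 (abs_nonneg x)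
  have hc6 : K * (|(N : ℝ) * x| / N) < 1 / 6 := by rw [ex]; linarith
  have hρ0 : 0 ≤ gaugeR (4 * (K * |x|)) := gaugeR_nonneg (by linarith) (by linarith)
  have hρ1 : gaugeR (4 * (K * |x|)) < 1 := gaugeR_lt_one_of_le (by linarith) h
  refine star_massGapAt_of_unique x hρ0 hρ1 3 (fun L _ hL => ?_)
    (StarSUN.hasUniqueGibbsMeasure_of_oneLinkKRModulus hN hK0 hR' hmod h')
  obtain ⟨hK, hKloc, hH1, hH2⟩ := star_window_of_oneLinkKRModulus (L := L) hL hN hK0 hR' hmod hc6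
  refine ⟨_, hK, hKloc, hH1, fun s e he => ?_⟩
  rw [hH2 s e he, ex]

/-! ### Hypothesis-free rows for every `SU(N)`, `N ≥ 2` (Bakry–Émery modulus) -/

/-- **`MassGapAt 4 N x` FOR EVERY `SU(N)`, `N ≥ 2`, AT EVERY 't Hooft `|x| ≤ 9/308`, HYPOTHESIS-FREE**
(DLR uniqueness + the Shen–Zhu–Zhu covariance clause for every DLR state of the `ℤ⁴` specification at tree
coupling `N·x`): the generic star window with the Bakry–Émery modulus `oneLinkKRModulus_SU`,
`K = 1/(1/2 − 6|x|)`.  DERIVED here; printed window `|x| < 1/48`. [folklore] -/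
theorem massGapAt_SU_star (hN : 2 ≤ N) {x : ℝ} (h : |x| ≤ 9 / 308) : MassGapAt 4 N x := by
  have hx0 : 0 ≤ |x| := abs_nonneg x
  have h1 : |x| * 6 < 1 / 2 := by linarith
  have hpos : 0 < 1 / 2 - |x| * 6 := by linarith
  have hK0 : 0 ≤ 1 / (1 / 2 - |x| * 6) := (one_div_pos.2 hpos).le
  have h4 : 4 * (1 / (1 / 2 - |x| * 6) * |x|) ≤ 9 / 25 := by
    rw [show 4 * (1 / (1 / 2 - |x| * 6) * |x|) = (4 * |x|) / (1 / 2 - |x| * 6) by ring,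
      div_le_iff₀ hpos]
    linarith
  exact star_massGapAt_of_oneLinkKRModulus (by omega) hK0 le_rfl (oneLinkKRModulus_SU hN h1) h4

/-- **`MassGapBelow 4 N (9/308)` for every `N ≥ 2`, hypothesis-free** (every 't Hooft `|x| < 9/308`).
[folklore] -/
theorem massGapBelow_SU_star (hN : 2 ≤ N) : MassGapBelow 4 N (9 / 308) :=
  fun _ hx => massGapAt_SU_star hN hx.le

/-- **THE CELL'S TRACK-(a) TARGET TYPE FOR EVERY `SU(N)`, `N ≥ 2`, `d = 4`, HYPOTHESIS-FREE:
`ImprovedThreshold 4 N (9/308)`** — `1/(16·3) = 1/48 < 9/308` and `MassGapBelow 4 N (9/308)`: DLR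
uniqueness and exponential clustering of Lipschitz cylinder covariances for every DLR state at every
't Hooft `|x| < 9/308 = 0.02922…` (`×108/77 = 1.40` beyond the printed Shen–Zhu–Zhu window; the cell's sharp
Bakry–Émery `1/32` for all `N` stays conditional on three printed facts, `HessianSharp.improvedThreshold_sharp`;
`SU(2)` has the sharper unconditional `ImprovedThreshold 4 2 (9/100)`, `ImprovedThresholdStar`).  Lattice
strong-coupling statement; no rate beyond `∃ c > 0`; nothing about the continuum. [folklore] -/
theorem improvedThreshold_SU_star (hN : 2 ≤ N) : ImprovedThreshold 4 N (9 / 308) :=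
  ⟨by norm_num, massGapBelow_SU_star hN⟩

/-- Instance: **`ImprovedThreshold 4 3 (9/308)` — `SU(3)`, `d = 4`, hypothesis-free** (Wilson units
`β_W = 9x`: mass gap in the `MassGapAt` currency at every `|β_W| < 81/308 = 0.2629…`; printed `3/16`).
[folklore] -/
theorem su3_improvedThreshold : ImprovedThreshold 4 3 (9 / 308) :=
  improvedThreshold_SU_star (by norm_num)

/-- **`SU(3)` in Wilson units**: `MassGapAt 4 3 (β_W/9)` at every `|β_W| ≤ 81/308`, hypothesis-free.
[folklore] -/
theorem su3_massGapAt_le {βW : ℝ} (h : |βW| ≤ 81 / 308) : MassGapAt 4 3 (βW / 9) :=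
  massGapAt_SU_star (by norm_num) (by
    rw [abs_div, abs_of_pos (by norm_num : (0 : ℝ) < 9)]; linarith)

/-- **The SC-a currency `DLRMassGapAt 4 N x` for every `SU(N)`, `N ≥ 2`, at every 't Hooft `|x| ≤ 9/308`,
hypothesis-free** — the Literature predicate of the tree's all-`N` single-site row `dlrMassGapAt_SU`
(`|x| < 1/48`) and of `pub-balaban`'s `su3_dlrMassGapAt_lt` (`β_W < 3/16`), through the tree's dictionary
`massGapAt_iff_dlrMassGapAt` (the rate of the unique DLR state serves for all). [folklore] -/
theorem dlrMassGapAt_SU_star (hN : 2 ≤ N) {x : ℝ} (h : |x| ≤ 9 / 308) :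
    Balaban1983to89.StrongCouplingDobrushinWindow.DLRMassGapAt 4 N x :=
  massGapAt_iff_dlrMassGapAt.1 (massGapAt_SU_star hN h)

/-- **`SU(3)` in Wilson units, SC-a currency**: `DLRMassGapAt 4 3 (β_W/9)` at every `|β_W| ≤ 81/308 = 0.2629…`,
hypothesis-free — the SAME predicate as `pub-balaban`'s `su3_dlrMassGapAt_lt : 0 ≤ β_W → β_W < 3/16 →
DLRMassGapAt 4 3 (β_W/9)` (the printed Shen–Zhu–Zhu window), ×`1.40`. [folklore] -/
theorem su3_dlrMassGapAt_le {βW : ℝ} (h : |βW| ≤ 81 / 308) :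
    Balaban1983to89.StrongCouplingDobrushinWindow.DLRMassGapAt 4 3 (βW / 9) :=
  massGapAt_iff_dlrMassGapAt.1 (su3_massGapAt_le h)

/-- **THE STRONG-COUPLING PHASE PREDICATE FOR EVERY `SU(N)`, `N ≥ 2`, `d = 4`, HYPOTHESIS-FREE**
(`HessianSharp.StrongCouplingPhaseAt 4 N β`, the β-body of the tree's named fact `shenZhuZhu_strongCoupling`:
the periodic `SU(N)` states converge along the full sequence of sides to a translation-invariant state,
every infinite-volume limit equals it, and its plaquette–plaquette covariances decay exponentially) at every
tree coupling `|β|/N ≤ 9/308` — `massGapAt_SU_star` through p2's unconditional bridge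
`HessianSharp.strongCouplingPhaseAt_of_massGapAt`.  Printed window: `|β|/N < 1/48`. [folklore] -/
theorem strongCouplingPhaseAt_SU_star (hN : 2 ≤ N) {β : ℝ} (h : |β| / N ≤ 9 / 308) :
    HessianSharp.StrongCouplingPhaseAt 4 N β := by
  have hN0 : (0 : ℝ) < N := by exact_mod_cast (show 0 < N by omega)
  refine HessianSharp.strongCouplingPhaseAt_of_massGapAt hN (by norm_num) (massGapAt_SU_star hN ?_)
  rwa [abs_div, abs_of_pos hN0]

/-- **`SU(3)`: the strong-coupling phase predicate at every `|β_W| ≤ 81/308`** (tree coupling `β_W/3`),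
hypothesis-free. [folklore] -/
theorem su3_strongCouplingPhaseAt_le {βW : ℝ} (h : |βW| ≤ 81 / 308) :
    HessianSharp.StrongCouplingPhaseAt 4 3 (βW / 3) :=
  strongCouplingPhaseAt_SU_star (by norm_num) (by
    rw [abs_div, abs_of_pos (by norm_num : (0 : ℝ) < 3)]; push_cast; linarith)

/-- **`SU(3)`, CONDITIONAL ROW (class «K × C-iv modulo CERT-SPEC-sigma1-v2»): `MassGapAt 4 3 (β_W/9)` at every
`|β_W| ≤ 21/50 = 0.42`** given the one-link variance inequality `OneLinkVarianceBound 3 (11/30) (49/20)` — NOT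
proved here, certified as a computation by two engines of the cell `pub-balaban` and replayed by `pub-ymgap`
(the displayed hypothesis of the tree's `SlabAreaLawVariance` rows): the variance modulus on the ball
`R = 7/25 ≥ 2|β_W|/3` has `K = √((49/20)/(3(1/2 − 7/25))) ≤ 27/14` (`StarSUN.oneLinkKRModulus_mono_const`), and
`4·(27/14)·|β_W|/9 ≤ 9/25` iff `|β_W| ≤ 21/50`. [folklore] -/
theorem su3_massGapAt_le_of_varianceBound (hv : OneLinkVarianceBound 3 (11 / 30) (49 / 20)) {βW : ℝ}
    (h : |βW| ≤ 21 / 50) : MassGapAt 4 3 (βW / 9) := by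
  have hv' : OneLinkVarianceBound 3 (7 / 25) (49 / 20) := hv.mono (by norm_num) le_rfl
  have hmod := oneLinkKRModulus_of_varianceBound (N := 3) (by norm_num) (R := 7 / 25) (by norm_num)
    (by norm_num) hv'
  have hK : Real.sqrt (49 / 20 / ((3 : ℕ) * (1 / 2 - 7 / 25))) ≤ 27 / 14 := by
    rw [Real.sqrt_le_left (by norm_num)]
    norm_num
  have hmod' : OneLinkKRModulus 3 (7 / 25) (27 / 14) := StarSUN.oneLinkKRModulus_mono_const hmod hK
  have hx : |βW / 9| = |βW| / 9 := by rw [abs_div, abs_of_pos (by norm_num : (0 : ℝ) < 9)]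
  refine star_massGapAt_of_oneLinkKRModulus (N := 3) (by norm_num) (by norm_num) ?_ hmod' ?_
  · rw [hx]; linarith
  · rw [hx]; linarith

/-- The thresholds side by side ('t Hooft units, every `N ≥ 2`): printed `1/48` < this file's `9/308` < the
conditional sharp `1/32`; `(9/308)/(1/48) = 108/77`, `(9/308)/(1/32) = 72/77`. [folklore] -/
theorem threshold_numbers :
    (1 : ℝ) / 48 < 9 / 308 ∧ (9 : ℝ) / 308 < 1 / 32 ∧ (9 : ℝ) / 308 / (1 / 48) = 108 / 77 ∧
      (9 : ℝ) / 308 / (1 / 32) = 72 / 77 := by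
  norm_num

end Limit

end Summit.Ventures.YMGap.StarSUNLimit

end
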